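import Literature.NumberTheory.LFunctions.Zhang2022.KnifeEdgeLenZDegreeK0Piece
import Literature.NumberTheory.LFunctions.Zhang2022.KnifeEdgeLenZDegreeShortPolyDense

/-!
# Zhang (2022), rung F-S3 (Landau–Siegel programme, §D CHAIN #1, crux K0 = stmt-Parity-20459 `InClassSideTablesPiece`): the
# side-table slot RESTATED ON POLYNOMIAL SHORT PIECES (`InClassMeanPoly`) and the route's half-class endgame chain re-glued
# over it for design classes whose pieces are polynomial and short (`_poly` twins of `KnifeEdgeLenZDegreeK0Piece` Part 3)

Y. Zhang, *Discrete mean estimates and the Landau–Siegel zero*, arXiv:2211.02515v1 [Zhang2022LandauSiegel] — an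
unrefereed manuscript under adjudication. **WHAT THIS IS NOT: not a claim about Theorems 1–2 of arXiv:2211.02515, about
Landau–Siegel zeros, or about Parity. The programme SEARCHES and TYPES; no claim about Landau–Siegel zeros, Theorems 1–2 of
arXiv:2211.02515 or a repaired Margin232 until a kernel theorem says so. `InClassMeanPoly` is a bare `Prop` (a statement
SHAPE, asserted by no one); every `theorem` below is an implication between slot shapes and the tree's nodes.**

## Why (prover ls-knife-K0-p1 g2; lead WORDS #2 18:23:11Z, theory (G1)–(G6) 18:15:10Z, crit-1 (C1)–(C4) 18:21:36Z)

The side table `KnifeEdge.InClassMeanPiece c′` (p535985) is consumed ONLY at the three diagonal Gram entries of the closing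
design `(f, g₁, g₂)` (`gramEntryAsymp_psi_diag_piece`). The (8.10)–(8.12) gathering of Prop 7.1's `S_j` for profile data is
kernel on POLYNOMIAL SHORT pieces (`DipoleRule.inClassMean_polyShortPiece`, file `Zhang2022/Section8ProfileSjPoly`): so for a
design class `𝒞` whose pairs consist of polynomial pieces of lengths `< 1` the half-class endgame
(`theorem1_of_gradedClosesPsiOn_pack_eventually_piece`) needs the slot only on that class. This file types the slot on that
class — `InClassMeanPoly c′ := ∀ θ u u′, θ < 1 → PolyShortPiece θ u u′ → ∀ ε > 0, ForAllLarge (A → |discMean c′ χ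
(profPoly χ · u (⌊P⌋+1)) − mainTermForm u u′·𝔞𝔓| ≤ ε𝔞𝔓)` (error shape IDENTICAL to `InClassMeanPiece`; class token
`PolyShortPiece θ`, `θ < 1`) — and re-threads Part 3 of `KnifeEdgeLenZDegreeK0Piece` over it, with the class bound
`h𝒞 : 𝒞 f f′ g g′ → (∃ θ < 1, PolyShortPiece θ f f′) ∧ (∃ θ < 1, PolyShortPiece θ g g′)` (NOTE: `PolyShortPairs` itself allows
the full-length member `θ_f = 1` against a partner of length `θ_g < 0`, where the slot is NOT proved; the bound therefore names
lengths `< 1` explicitly rather than `𝒞 ⊆ PolyShortPairs`).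

## Contents
* `InClassMeanPoly` (shape); `inClassMeanPoly_of_inClassMeanPiece` (the in-class slot implies it — nothing is lost);
* `gramEntryAsymp_psi_diag_poly`, `gramEntryAsymp_psiOn_poly`, `notAEventually_of_gradedClosesPsiOn_poly`,
  `gradedClosesPsi_of_gradedClosesPsiOn_poly`, **`theorem1_of_gradedClosesPsiOn_pack_eventually_poly`** (the `_poly` glue twin).

No item of any route is restated here (D-0014: restating is the planner's); nothing is asserted about (A).

## References
* Y. Zhang, arXiv:2211.02515v1 (2022), §2 (2.16)–(2.17), p. 6; §7 Prop 7.1 (7.2); §8 (8.5), (8.23).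
  [cite: Zhang2022LandauSiegel, §2 (2.16), §7 Prop 7.1 (7.2), §8 (8.23)]
-/

noncomputable section

open Complex Real ComplexConjugate Set MeasureTheory intervalIntegral

namespace Literature.NumberTheory.LFunctions.Zhang2022

namespace KnifeEdge

open Repair Skeleton

/-! ### Part 1 — the slot on polynomial short pieces -/

section Slot

variable (c' : ℝ)

/-- **IN-CLASS SLOT ON POLYNOMIAL SHORT PIECES (shape, NOT asserted):** under (A), eventually in `D`, the discrete mean of the
polynomial of ONE polynomial short piece `u` (`PolyShortPiece θ u u′`, `θ < 1`) of length `P` is `𝔅(u)·𝔞𝔓 + o(𝔞𝔓)`,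
`𝔅 = mainTermForm` — the in-class slot `InClassMeanPiece c′` with its binder narrowed to the polynomial short pieces of the
route's designs. [cite: Zhang2022LandauSiegel, §7 Prop 7.1, §8 (8.23)] -/
def InClassMeanPoly : Prop :=
  ∀ (θ : ℝ) (u u' : ℝ → ℂ), θ < 1 → PolyShortPiece θ u u' → ∀ ε : ℝ, 0 < ε → ForAllLarge fun D _ χ => AssumptionA D χ →
    |discMean c' χ (fun x t => profPoly χ x u (⌊bigP D⌋₊ + 1) t) - mainTermForm u u' * frakA χ * frakP D|
      ≤ ε * frakA χ * frakP D

variable {c'}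

/-- The in-class slot implies the polynomial one (a polynomial short piece is an in-class piece) — nothing already proved over
`InClassMeanPiece` is lost. [cite: Zhang2022LandauSiegel, §8 (8.23)] -/
theorem inClassMeanPoly_of_inClassMeanPiece (h : InClassMeanPiece c') : InClassMeanPoly c' :=
  fun _ u u' _ hP ε hε => h u u' hP.inClassPiece ε hε

/-- Eventual form of the comparison. [cite: Zhang2022LandauSiegel, §8 (8.23)] -/
theorem inClassMeanPoly_eventually_of_inClassMeanPiece (h0 : ∃ c₁ : ℝ, ∀ c' : ℝ, c₁ ≤ c' → InClassMeanPiece c') :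
    ∃ c₁ : ℝ, ∀ c' : ℝ, c₁ ≤ c' → InClassMeanPoly c' := by
  obtain ⟨c₁, h₁⟩ := h0
  exact ⟨c₁, fun c' hc' => inClassMeanPoly_of_inClassMeanPiece (h₁ c' hc')⟩

end Slot

/-! ### Part 2 — the half-class chain over the polynomial slot -/

section PolyChain

variable {c' : ℝ} {𝒞 : PairClass} {X₁ Y₁ X₂ : PairFunctional} {f f' g₁ g₁' g₂ g₂' : ℝ → ℂ}

/-- a real discrete mean within `δ𝔞𝔓` of its constant, read as a complex entry estimate. [folklore] -/
private theorem entry_of_real_poly {x m a p δ : ℝ} (h : |x - m * a * p| ≤ δ * a * p) :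
    ‖((x : ℝ) : ℂ) - (m : ℂ) * a * p‖ ≤ δ * a * p := by
  rw [← Complex.ofReal_mul, ← Complex.ofReal_mul, ← Complex.ofReal_sub, Complex.norm_real, Real.norm_eq_abs]
  exact h

/-- **Diagonal slots from the polynomial side table** (`gramEntryAsymp_psi_diag_piece` with `InClassMeanPoly` in place of
`InClassMeanPiece`, the three design pieces polynomial and short). [cite: Zhang2022LandauSiegel, §7 Prop 7.1, §8 (8.2)–(8.3)] -/
theorem gramEntryAsymp_psi_diag_poly (h0 : InClassMeanPoly c') (h22 : Prop22i)
    (hf : ∃ θ : ℝ, θ < 1 ∧ PolyShortPiece θ f f') (hg₁ : ∃ θ : ℝ, θ < 1 ∧ PolyShortPiece θ g₁ g₁')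
    (hg₂ : ∃ θ : ℝ, θ < 1 ∧ PolyShortPiece θ g₂ g₂') (k : Fin 3) :
    GramEntryAsymp c' (psiPieceTable f g₁ g₂ k) (psiPieceTable f g₁ g₂ k)
      (gradedMainMatrix X₁ Y₁ X₂ f f' g₁ g₁' g₂ g₂' k k) := by
  have hsel : ∃ (g g' : ℝ → ℂ), (∃ θ : ℝ, θ < 1 ∧ PolyShortPiece θ g g') ∧
      gradedMainMatrix X₁ Y₁ X₂ f f' g₁ g₁' g₂ g₂' k k = (mainTermForm g g' : ℂ) ∧
      ∀ (D : ℕ) [NeZero D] (χ : DirichletCharacter ℂ D),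
        (basePiece χ f g₁ g₂ k = fun x t => profPoly χ x g (⌊bigP D⌋₊ + 1) t) ∨
        (basePiece χ f g₁ g₂ k = fun x t => conj (profPoly χ x g (⌊bigP D⌋₊ + 1) t)) := by
    fin_cases k
    · exact ⟨f, f', hf, rfl, fun D _ χ => Or.inl rfl⟩
    · exact ⟨g₁, g₁', hg₁, rfl, fun D _ χ => Or.inr rfl⟩
    · exact ⟨g₂, g₂', hg₂, rfl, fun D _ χ => Or.inr rfl⟩
  obtain ⟨g, g', ⟨θ, hθ, hg⟩, hM, hbase⟩ := hsel
  intro ε hε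
  obtain ⟨D₁, hD₁⟩ := (h0 θ g g' hθ hg ε hε).and h22
  refine ⟨max D₁ 3, fun D _ χ hD hq hp hA => ?_⟩
  have hD3 : 3 ≤ D := le_trans (le_max_right _ _) hD
  obtain ⟨hmean, h22'⟩ := hD₁ D χ (le_trans (le_max_left _ _) hD) hq hp
  have hW := norm_Zpsi_eq_one_of (χ := χ) hD3 h22'
  have hdiag : discPolar c' χ (psiPieceTable f g₁ g₂ k D χ) (psiPieceTable f g₁ g₂ k D χ) =
      ((discMean c' χ (fun x t => profPoly χ x g (⌊bigP D⌋₊ + 1) t) : ℝ) : ℂ) := by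
    rw [discPolar_self]
    simp only [psiPieceTable, psiGradedPiece, discMean_zTwistW (W := fun x s => GammaFactor.Zfac x.ψ s) hW]
    rcases hbase D χ with hb | hb
    · rw [hb]
    · rw [hb, discMean_conj]
  rw [hdiag, hM]
  exact entry_of_real_poly (hmean hA)

/-- **All nine Gram-entry slots at a `𝒞`-design from tables ON `𝒞` and the polynomial side table**, for a class whose
pairs consist of polynomial pieces of lengths `< 1`. [cite: Zhang2022LandauSiegel, §2 (2.16) (2.17), §8 (8.5)] -/
theorem gramEntryAsymp_psiOn_poly (h0 : InClassMeanPoly c') (h1 : CrossTablePsiOn c' 𝒞 1 X₁)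
    (h21 : DualCrossTablePsiOn c' 𝒞 1 Y₁) (h2 : CrossTablePsiOn c' 𝒞 2 X₂) (h22 : Prop22i)
    (h𝒞 : ∀ f f' g g', 𝒞 f f' g g' →
      (∃ θ : ℝ, θ < 1 ∧ PolyShortPiece θ f f') ∧ (∃ θ : ℝ, θ < 1 ∧ PolyShortPiece θ g g'))
    (c01 : 𝒞 f f' g₁ g₁') (c02 : 𝒞 f f' g₂ g₂') (c12 : 𝒞 g₁ g₁' g₂ g₂') :
    ∀ a b, GramEntryAsymp c' (psiPieceTable f g₁ g₂ a) (psiPieceTable f g₁ g₂ b)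
      (gradedMainMatrix X₁ Y₁ X₂ f f' g₁ g₁' g₂ g₂' a b) := by
  have hf : ∃ θ : ℝ, θ < 1 ∧ PolyShortPiece θ f f' := (h𝒞 _ _ _ _ c01).1
  have hg₁ : ∃ θ : ℝ, θ < 1 ∧ PolyShortPiece θ g₁ g₁' := (h𝒞 _ _ _ _ c01).2
  have hg₂ : ∃ θ : ℝ, θ < 1 ∧ PolyShortPiece θ g₂ g₂' := (h𝒞 _ _ _ _ c02).2
  have hfI : InClassPiece f f' := by obtain ⟨θ, -, h⟩ := hf; exact h.inClassPiece
  have hg₁I : InClassPiece g₁ g₁' := by obtain ⟨θ, -, h⟩ := hg₁; exact h.inClassPiece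
  have hg₂I : InClassPiece g₂ g₂' := by obtain ⟨θ, -, h⟩ := hg₂; exact h.inClassPiece
  obtain ⟨e10, e20, e21⟩ := gramEntryAsymp_psiOn_offdiag h1 h21 h2 h22 hfI hg₁I hg₂I c01 c02 c12
  refine gramEntryAsymp_of_lower (gradedMainMatrix_conj_symm X₁ Y₁ X₂ f f' g₁ g₁' g₂ g₂') fun a b hba => ?_
  fin_cases a <;> fin_cases b
  · exact gramEntryAsymp_psi_diag_poly h0 h22 hf hg₁ hg₂ 0
  · exact absurd hba (by decide)
  · exact absurd hba (by decide)
  · exact e10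
  · exact gramEntryAsymp_psi_diag_poly h0 h22 hf hg₁ hg₂ 1
  · exact absurd hba (by decide)
  · exact e20
  · exact e21
  · exact gramEntryAsymp_psi_diag_poly h0 h22 hf hg₁ hg₂ 2

/-- **Endgame ON a polynomial-short class over the polynomial side table:** `InClassMeanPoly c′` ∧ Prop. 2.2 (i) ∧ Lemma 2.3
∧ the package ON `𝒞` ⇒ (A) fails for every real primitive character to every large modulus.
[cite: Zhang2022LandauSiegel, §2 p. 6, (2.16)] -/
theorem notAEventually_of_gradedClosesPsiOn_poly (h0 : InClassMeanPoly c') (h22 : Prop22i) (h23 : Lemma23 c')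
    (h𝒞 : ∀ f f' g g', 𝒞 f f' g g' →
      (∃ θ : ℝ, θ < 1 ∧ PolyShortPiece θ f f') ∧ (∃ θ : ℝ, θ < 1 ∧ PolyShortPiece θ g g'))
    (hG : GradedClosesPsiOn c' 𝒞) : ForAllLarge fun D _ χ => ¬ AssumptionA D χ := by
  obtain ⟨X₁, Y₁, X₂, h1, h21, h2, hC⟩ := hG
  obtain ⟨f, f', g₁, g₁', g₂, g₂', s, -, -, -, c01, c02, c12, hneg⟩ := hC
  exact eventually_not_assumptionA_of_gramSlots
    (gramEntryAsymp_psiOn_poly h0 h1 h21 h2 h22 h𝒞 c01 c02 c12) hneg h22 h23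

/-- … hence the FULL package `GradedClosesPsi c′`. [cite: Zhang2022LandauSiegel, §2 p. 6, (2.16)] -/
theorem gradedClosesPsi_of_gradedClosesPsiOn_poly (h0 : InClassMeanPoly c') (h22 : Prop22i) (h23 : Lemma23 c')
    (h𝒞 : ∀ f f' g g', 𝒞 f f' g g' →
      (∃ θ : ℝ, θ < 1 ∧ PolyShortPiece θ f f') ∧ (∃ θ : ℝ, θ < 1 ∧ PolyShortPiece θ g g'))
    (hG : GradedClosesPsiOn c' 𝒞) : GradedClosesPsi c' :=
  gradedClosesPsi_of_notAEventually (notAEventually_of_gradedClosesPsiOn_poly h0 h22 h23 h𝒞 hG) c'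

/-- **THE `_poly` GLUE TWIN:** the polynomial side table for all large `c′` ∧ the package ON a class of polynomial short pairs
(lengths `< 1`) for all large `c′` ⇒ Theorem 1 (`theorem1_of_gradedClosesPsiOn_pack_eventually_piece` re-threaded; Prop.
2.2 (i) / Lemma 2.3 discharged by the tree). [cite: Zhang2022LandauSiegel, §1 Theorem 1, §2 p. 6] -/
theorem theorem1_of_gradedClosesPsiOn_pack_eventually_poly
    (h0 : ∃ c₁ : ℝ, ∀ c' : ℝ, c₁ ≤ c' → InClassMeanPoly c')
    (h : ∃ c₂ : ℝ, ∀ c' : ℝ, c₂ ≤ c' → GradedClosesPsiOn c' 𝒞)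
    (h𝒞 : ∀ f f' g g', 𝒞 f f' g g' →
      (∃ θ : ℝ, θ < 1 ∧ PolyShortPiece θ f f') ∧ (∃ θ : ℝ, θ < 1 ∧ PolyShortPiece θ g g')) : Theorem1 := by
  obtain ⟨c₀, -, h23⟩ := lemma23_eventually
  obtain ⟨c₁, h₁⟩ := h0
  obtain ⟨c₂, h₂⟩ := h
  set c' := max c₀ (max c₁ c₂) with hc'
  have hc0 : c₀ ≤ c' := le_max_left _ _
  have hc1 : c₁ ≤ c' := le_trans (le_max_left _ _) (le_max_right _ _)
  have hc2 : c₂ ≤ c' := le_trans (le_max_right _ _) (le_max_right _ _)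
  have hnotA := notAEventually_of_gradedClosesPsiOn_poly (h₁ c' hc1) prop22i_holds (h23 c' hc0) h𝒞 (h₂ c' hc2)
  exact Skeleton.theorem1_of_eventually_not_assumptionA hnotA

/-- … and Theorem 2. [cite: Zhang2022LandauSiegel, §1 Theorem 2] -/
theorem theorem2_of_gradedClosesPsiOn_pack_eventually_poly
    (h0 : ∃ c₁ : ℝ, ∀ c' : ℝ, c₁ ≤ c' → InClassMeanPoly c')
    (h : ∃ c₂ : ℝ, ∀ c' : ℝ, c₂ ≤ c' → GradedClosesPsiOn c' 𝒞)
    (h𝒞 : ∀ f f' g g', 𝒞 f f' g g' →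
      (∃ θ : ℝ, θ < 1 ∧ PolyShortPiece θ f f') ∧ (∃ θ : ℝ, θ < 1 ∧ PolyShortPiece θ g g')) : Theorem2 :=
  Skeleton.theorem2_of_theorem1 (theorem1_of_gradedClosesPsiOn_pack_eventually_poly h0 h h𝒞)

end PolyChain

end KnifeEdge

end Literature.NumberTheory.LFunctions.Zhang2022

end
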